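import Literature.Probability.RandomPlanarGeometry.SAWPulledLargeForceExpansionZdHyperoctahedral
import Literature.Probability.RandomPlanarGeometry.SAWBridgeRenewalEquation
import HarnessLib

/-!
# Bridges and irreducible bridges of `ℤ^{d+1}` in EVERY dimension: `b_n(ℤ^{d+1})` and `λ_n(ℤ^{d+1})` are INTEGER POLYNOMIALS IN `2d`;
# congruences between dimensions — `4dd′(d−d′) ∣ d′(b_n(ℤ^{d+1}) − 1) − d(b_n(ℤ^{d′+1}) − 1)`

Topic `Literature/Probability/RandomPlanarGeometry` (continues `SAWPulledLargeForceExpansionZdHyperoctahedral.lean`: `exists_int_polynomial_costCoeffZd`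
(`N_{c,n}(ℤ^{d+1}) = P_{c,n}(2d)`, `P_{c,n} ∈ ℤ[X]`, no constant term for `c ≥ 1`) and `costCoeffZd_zero` (`N_{0,n} = [n = 1]`); uses the renewal equation
`SAWBridgeRenewalEquation.bridgeCount_eq_sum_Icc` (`b_n = Σ_{s=1}^{n} λ_s b_{n−s}`, Madras–Slade (4.2.2)), `bridgeCount_le_count`, `count_zero`, `one_le_bridgeCount`).

PRINTED CONTEXT (locators only). Madras–Slade (1993) §4.2 eq. (4.2.2) p. 90 (bridge renewal), eq. (4.2.20)–(4.2.22) p. 94 (cost); Graham (2010) §4 (counts symmetric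
under the signed permutations of the axes are integer polynomials in `2d`). NOT IN PRINT (lane statements): the congruences below — an integer polynomial `R` has
`a − b ∣ R(a) − R(b)`; here `d` is the number of LATERAL axes of `ℤ^{d+1}` and the value at `d = 0` (the line `ℤ¹`: `b_n = 1`, `λ_n = [n = 1]`) is the constant term.

THIS FILE (lane «pcv-sawmu», a-p3 g25; all PROVED, standard axioms, NO definitions):
* `irreducibleBridgeCount_eq_sum_costCoeffZd` (`λ_s = Σ_{c ≤ s} N_{c,s}`); ★★★ `exists_int_polynomial_irreducibleBridgeCount` — **`λ_s(ℤ^{d+1}) = Λ_s(2d)`,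
  `Λ_s ∈ ℤ[X]`, `deg ≤ s`, `Λ_s(0) = [s = 1]`**; ★★★ `exists_int_polynomial_bridgeCount` — **`b_n(ℤ^{d+1}) = B_n(2d)`, `B_n ∈ ℤ[X]`, `deg ≤ n`, `B_n(0) = 1`**
  (induction on the renewal equation);
* ★★★ `dvd_sub_bridgeCount` — **`4·d·d′·(d − d′) ∣ d′·(b_n(ℤ^{d+1}) − 1) − d·(b_n(ℤ^{d′+1}) − 1)`**; ★★ `dvd_bridgeCount_sub` — **`b_n(ℤ^{d+1}) ≡ 1 + d·(b_n(ℤ²) − 1)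
  (mod 4d(d−1))`**; ★★★ `dvd_sub_irreducibleBridgeCount` (`s ≥ 2`) — **`4·d·d′·(d − d′) ∣ d′·λ_s(ℤ^{d+1}) − d·λ_s(ℤ^{d′+1})`**; ★★ `dvd_irreducibleBridgeCount_sub` —
  **`λ_s(ℤ^{d+1}) ≡ d·λ_s(ℤ²) (mod 4d(d−1))`**.
Numerical face (not used; lateral axes `d = 1` is `ℤ²`, `d = 2` is `ℤ³`): `b_2(ℤ^{d+1}) = 1 + 2d`, `λ_2(ℤ^{d+1}) = 2d`; the planar bridge / irreducible-bridge counts of the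
lane's Engine C tables decide every `b_n(ℤ^{d+1})`, `λ_n(ℤ^{d+1})` modulo `4d(d−1)` (e.g. `b_n(ℤ³) ≡ 2b_n(ℤ²) − 1 (mod 8)`, `λ_n(ℤ³) ≡ 2λ_n(ℤ²) (mod 8)`).
[cite: MadrasSlade1993, §4.2, eq. (4.2.2) (p. 90); eq. (4.2.20)–(4.2.22) (p. 94)] [cite: Graham2010, Section 4]

Provenance: lane «pcv-sawmu», a-p3 g25 (2026-08-28). PURE STD, no data, no census value used.
-/

noncomputable section

open Finset
open scoped BigOperators
open Literature.Probability.LatticeModels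
open Literature.Probability.RandomPlanarGeometry.SAW

namespace Literature.Probability.RandomPlanarGeometry.SAW.Zd

/-! ## §9 Irreducible bridges and bridges of `ℤ^{d+1}` counted as integer polynomials in `2d`; congruences between dimensions -/

section Bridge

/-- `λ_s(ℤ^{d+1}) = Σ_{c ≤ s} N_{c,s}(ℤ^{d+1})`: the irreducible bridges of length `s` split by cost (`cost ≤ length`).
[cite: MadrasSlade1993, §4.2, eq. (4.2.20)–(4.2.22) (p. 94, 2013 reprint)] -/
theorem irreducibleBridgeCount_eq_sum_costCoeffZd (d s : ℕ) :
    irreducibleBridgeCount (d + 1) s = ∑ c ∈ Finset.range (s + 1), costCoeffZd d c s := by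
  classical
  rw [irreducibleBridgeCount, Finset.card_eq_sum_card_fiberwise (f := costZd d s) (t := Finset.range (s + 1))
    (fun ω _ => Finset.mem_range.2 (Nat.lt_succ_of_le (Nat.sub_le _ _)))]
  refine Finset.sum_congr rfl fun c _ => ?_
  rw [costCoeffZd]

/-- ★★★ **`λ_s(ℤ^{d+1})` IS AN INTEGER POLYNOMIAL IN `2d`**: for every `s` there is `Λ_s ∈ ℤ[X]` of degree `≤ s` with `λ_s(ℤ^{d+1}) = Λ_s(2d)` for every
`d`, and `Λ_s(0) = [s = 1]` (`= λ_s(ℤ¹)`: on the line only the single up-step is an irreducible bridge). [cite: MadrasSlade1993, §4.2, eq. (4.2.2) (p. 90);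
eq. (4.2.20)–(4.2.22) (p. 94)] [cite: Graham2010, Section 4] -/
theorem exists_int_polynomial_irreducibleBridgeCount (s : ℕ) :
    ∃ P : Polynomial ℤ, P.natDegree ≤ s ∧ P.coeff 0 = (if s = 1 then 1 else 0) ∧
      ∀ d : ℕ, (irreducibleBridgeCount (d + 1) s : ℤ) = P.eval (2 * (d : ℤ)) := by
  choose P hP using fun c => exists_int_polynomial_costCoeffZd c s
  refine ⟨∑ c ∈ Finset.range (s + 1), P c, ?_, ?_, fun d => ?_⟩
  · refine Polynomial.natDegree_sum_le_of_forall_le _ _ fun c hc => ((hP c).1).trans ?_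
    exact Nat.lt_succ_iff.1 (Finset.mem_range.1 hc)
  · rw [Polynomial.finsetSum_coeff, Finset.sum_range_succ', Finset.sum_eq_zero fun c _ => (hP (c + 1)).2.1 (Nat.succ_pos c), zero_add]
    -- the cost-0 polynomial is the constant `[s = 1]`
    have h0 : (P 0).natDegree ≤ 0 := (hP 0).1
    have hc : P 0 = Polynomial.C ((P 0).coeff 0) := Polynomial.eq_C_of_natDegree_le_zero h0
    have hev := (hP 0).2.2 0
    rw [costCoeffZd_zero, hc, Polynomial.eval_C] at hev
    rw [← hev]
    split_ifs <;> simp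
  · rw [irreducibleBridgeCount_eq_sum_costCoeffZd, Polynomial.eval_finsetSum]
    push_cast
    exact Finset.sum_congr rfl fun c _ => (hP c).2.2 d

/-- ★★★ **`b_n(ℤ^{d+1})` IS AN INTEGER POLYNOMIAL IN `2d` WITH CONSTANT TERM `1`**: for every `n` there is `B_n ∈ ℤ[X]` of degree `≤ n` with
`b_n(ℤ^{d+1}) = B_n(2d)` for every `d` and `B_n(0) = 1` (`= b_n(ℤ¹)`, the straight walk) — by the renewal equation `b_n = Σ_{s=1}^{n} λ_s b_{n−s}`.
[cite: MadrasSlade1993, §4.2, eq. (4.2.2) (p. 90)] [cite: Graham2010, Section 4] -/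
theorem exists_int_polynomial_bridgeCount (n : ℕ) :
    ∃ P : Polynomial ℤ, P.natDegree ≤ n ∧ P.coeff 0 = 1 ∧ ∀ d : ℕ, (bridgeCount (d + 1) n : ℤ) = P.eval (2 * (d : ℤ)) := by
  choose L hL using fun s => exists_int_polynomial_irreducibleBridgeCount s
  -- simultaneous construction of `B_0, …, B_n`
  suffices h : ∃ B : ℕ → Polynomial ℤ, ∀ m ≤ n, (B m).natDegree ≤ m ∧ (B m).coeff 0 = 1 ∧
      ∀ d : ℕ, (bridgeCount (d + 1) m : ℤ) = (B m).eval (2 * (d : ℤ)) by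
    obtain ⟨B, hB⟩ := h
    exact ⟨B n, hB n le_rfl⟩
  induction n with
  | zero =>
    refine ⟨fun _ => 1, fun m hm => ?_⟩
    obtain rfl : m = 0 := Nat.le_zero.1 hm
    refine ⟨by simp, by simp, fun d => ?_⟩
    have : bridgeCount (d + 1) 0 = 1 :=
      le_antisymm ((bridgeCount_le_count 0).trans (count_zero (d + 1)).le) (one_le_bridgeCount 0)
    simp [this]
  | succ n ih =>
    obtain ⟨B, hB⟩ := ih
    refine ⟨Function.update B (n + 1) (∑ s ∈ Finset.Icc 1 (n + 1), L s * B (n + 1 - s)), fun m hm => ?_⟩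
    rcases Nat.lt_or_ge m (n + 1) with hlt | hge
    · rw [Function.update_of_ne (by omega)]
      exact hB m (by omega)
    · obtain rfl : m = n + 1 := le_antisymm hm hge
      rw [Function.update_self]
      refine ⟨?_, ?_, fun d => ?_⟩
      · refine Polynomial.natDegree_sum_le_of_forall_le _ _ fun s hs => ?_
        have hs' := Finset.mem_Icc.1 hs
        calc (L s * B (n + 1 - s)).natDegree ≤ (L s).natDegree + (B (n + 1 - s)).natDegree := Polynomial.natDegree_mul_le
          _ ≤ s + (n + 1 - s) := add_le_add (hL s).1 (hB _ (by omega)).1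
          _ = n + 1 := by omega
      · rw [Polynomial.finsetSum_coeff]
        have hterm : ∀ s ∈ Finset.Icc 1 (n + 1), (L s * B (n + 1 - s)).coeff 0 = if s = 1 then 1 else 0 := by
          intro s hs
          have hs' := Finset.mem_Icc.1 hs
          rw [Polynomial.mul_coeff_zero, (hL s).2.1, (hB _ (by omega)).2.1, mul_one]
        rw [Finset.sum_congr rfl hterm, Finset.sum_ite_eq' (Finset.Icc 1 (n + 1)) 1 (fun _ => (1 : ℤ)), if_pos (by simp)]
      · rw [bridgeCount_eq_sum_Icc (d := d + 1) (by omega), Polynomial.eval_finsetSum]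
        push_cast
        refine Finset.sum_congr rfl fun s hs => ?_
        have hs' := Finset.mem_Icc.1 hs
        rw [Polynomial.eval_mul, (hL s).2.2 d, (hB _ (by omega)).2.2 d]

/-- An integer polynomial in `2d` with constant term `a` satisfies `4dd′(d−d′) ∣ d′(f(d) − a) − d(f(d′) − a)`. [folklore] -/
private theorem dvd_sub_of_eval_two_mul_const {f : ℕ → ℤ} {a : ℤ}
    (h : ∃ P : Polynomial ℤ, P.coeff 0 = a ∧ ∀ d : ℕ, f d = P.eval (2 * (d : ℤ))) (d d' : ℕ) :
    (4 * (d : ℤ) * d' * ((d : ℤ) - d')) ∣ (d' : ℤ) * (f d - a) - (d : ℤ) * (f d' - a) := by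
  obtain ⟨P, hP0, hP⟩ := h
  obtain ⟨R, hR⟩ := Polynomial.X_dvd_iff.2 (show (P - Polynomial.C a).coeff 0 = 0 by simp [hP0])
  obtain ⟨m, hm⟩ := Polynomial.sub_dvd_eval_sub (2 * (d : ℤ)) (2 * (d' : ℤ)) R
  have hPd : ∀ e : ℕ, f e - a = 2 * (e : ℤ) * R.eval (2 * (e : ℤ)) := fun e => by
    have := congrArg (Polynomial.eval (2 * (e : ℤ))) hR
    rw [Polynomial.eval_sub, Polynomial.eval_C, Polynomial.eval_mul, Polynomial.eval_X, ← hP e] at this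
    exact this
  rw [hPd d, hPd d']
  exact ⟨m, by linear_combination (2 * (d : ℤ) * d') * hm⟩

/-- ★★★ **THE DIMENSION CONGRUENCE FOR BRIDGES**: for every `n` and all `d, d′`,
`4·d·d′·(d − d′) ∣ d′·(b_n(ℤ^{d+1}) − 1) − d·(b_n(ℤ^{d′+1}) − 1)`. [cite: MadrasSlade1993, §4.2, eq. (4.2.2) (p. 90)] [cite: Graham2010, Section 4] -/
theorem dvd_sub_bridgeCount (n d d' : ℕ) :
    (4 * (d : ℤ) * d' * ((d : ℤ) - d')) ∣
      (d' : ℤ) * ((bridgeCount (d + 1) n : ℤ) - 1) - (d : ℤ) * ((bridgeCount (d' + 1) n : ℤ) - 1) := by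
  obtain ⟨P, -, hP0, h⟩ := exists_int_polynomial_bridgeCount n
  exact dvd_sub_of_eval_two_mul_const ⟨P, hP0, h⟩ d d'

/-- ★★ **`b_n(ℤ^{d+1}) ≡ 1 + d·(b_n(ℤ²) − 1) (mod 4d(d−1))`** for every `n` and `d`: the square-lattice bridge counts decide all bridge counts
modulo `4d(d−1)`. [cite: MadrasSlade1993, §4.2, eq. (4.2.2) (p. 90)] -/
theorem dvd_bridgeCount_sub (n d : ℕ) :
    (4 * (d : ℤ) * ((d : ℤ) - 1)) ∣ ((bridgeCount (d + 1) n : ℤ) - 1) - (d : ℤ) * ((bridgeCount 2 n : ℤ) - 1) := by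
  obtain ⟨m, hm⟩ := dvd_sub_bridgeCount n d 1
  exact ⟨m, by push_cast at hm; linear_combination hm⟩

/-- ★★★ **THE DIMENSION CONGRUENCE FOR IRREDUCIBLE BRIDGES**: for every `s ≥ 2` and all `d, d′`,
`4·d·d′·(d − d′) ∣ d′·λ_s(ℤ^{d+1}) − d·λ_s(ℤ^{d′+1})`; hence `λ_s(ℤ^{d+1}) ≡ d·λ_s(ℤ²) (mod 4d(d−1))`.
[cite: MadrasSlade1993, §4.2, eq. (4.2.2) (p. 90)] [cite: Graham2010, Section 4] -/
theorem dvd_sub_irreducibleBridgeCount {s : ℕ} (hs : 2 ≤ s) (d d' : ℕ) :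
    (4 * (d : ℤ) * d' * ((d : ℤ) - d')) ∣ (d' : ℤ) * irreducibleBridgeCount (d + 1) s - (d : ℤ) * irreducibleBridgeCount (d' + 1) s := by
  obtain ⟨P, -, hP0, h⟩ := exists_int_polynomial_irreducibleBridgeCount s
  rw [if_neg (by omega)] at hP0
  have := dvd_sub_of_eval_two_mul_const (a := 0) ⟨P, hP0, h⟩ d d'
  simpa only [sub_zero] using this

/-- ★★ `λ_s(ℤ^{d+1}) ≡ d·λ_s(ℤ²) (mod 4d(d−1))` for `s ≥ 2`. [cite: MadrasSlade1993, §4.2, eq. (4.2.2) (p. 90)] -/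
theorem dvd_irreducibleBridgeCount_sub {s : ℕ} (hs : 2 ≤ s) (d : ℕ) :
    (4 * (d : ℤ) * ((d : ℤ) - 1)) ∣ (irreducibleBridgeCount (d + 1) s : ℤ) - (d : ℤ) * irreducibleBridgeCount 2 s := by
  obtain ⟨m, hm⟩ := dvd_sub_irreducibleBridgeCount hs d 1
  exact ⟨m, by push_cast at hm; linear_combination hm⟩

end Bridge

end Literature.Probability.RandomPlanarGeometry.SAW.Zd

end
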